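import Mathlib
import Literature.Computability.AlgebraicComplexity.AlderStrassen
import Summits.MatrixMultiplication.MatrixMultiplication.Theorems.FidelityWitnessesFidelityThesisSepMajorantSingleProduct

/-!
# Twisted captures are bounded by the crux body (converse direction of line `frame-negativity-singlet-fraction`, Stage A)

Crux `FidelityWitnesses.DiagonalPowerDecay` (stmt-MatrixMultiplication-14053), line `frame-negativity-singlet-fraction`
(lead prover-line-stmt-MatrixMultiplication-14053-0). Slots as in the line: `S a b c`, `a = (κ,ν)` output, `b = (κ,μ)`,
`c = (μ',ν)`, all in `Fin n × Fin n`; `matMulTensor ℂ n n n a b c = [a.1 = b.1 ∧ b.2 = c.1 ∧ a.2 = c.2]`.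

For an `n × n` matrix `A` the `A`-TWISTED CAPTURE of a family `e` of vectors of `ℂ^{P n} ⊗ ℂ^{P n}` is
`cap_A(e) := Σ_s Σ_{a=(κ,ν)} |Σ_{m,m'} e_s (κ,m) (m',ν) · A m m'|²` (for `A = 1` this is the line's capture `cap e`,
the unnormalised singlet fraction of the reduced middle-pair operator `R_E = Tr_{κν} P_E`; in general it is
`⟨ψ_A| R_E |ψ_A⟩` for the vector `ψ_A = conj A`).  THEOREM (`capTwist_le_of_body`): if the crux body holds with constants
`(C, δ)`, then for every orthonormal frame `e` lying in the span of `r ≤ n²` products `u_l ⊗ v_l` and every CONTRACTION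
`A` (`‖A x‖ ≤ ‖x‖`), `cap_A(e) ≤ C · n^{3−2δ}`.  Proof: the tensor `S` with output slices
`S(a,·,·) = Σ_s conj(c_{s,a}) e_s` (`c_{s,a}` the inner sums) has `‖S‖² = cap_A(e)` (Parseval) and pairs with the
`A`-twisted matrix multiplication tensor to `cap_A(e)`; pushing `A` from the tensor onto the third slot of `S`
(`twist`) gives a tensor of rank `≤ r ≤ n²` (a linear map on one factor of each triad), of norm `≤ ‖S‖`
(contraction), whose overlap with `⟨n,n,n⟩` itself is `cap_A(e)`; the body then reads
`cap_A(e)² ≤ C n^{3−2δ} · cap_A(e)`.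

This is the half of the equivalence `DiagonalPowerDecay ⟺ stub_middlePairNegativityDecay` that consumes the crux; the
other half (trace norm of the partially transposed reduction versus twisted captures) is pure matrix analysis (Stage B).
-/

noncomputable section

-- the tree's namespace `Summit.MatrixMultiplication.MatrixMultiplication.…` repeats a component by design
set_option linter.dupNamespace false

namespace Summit.MatrixMultiplication.MatrixMultiplication.Theorems.DiagonalPowerDecay

open scoped BigOperators ComplexConjugate
open Literature.Computability.AlgebraicComplexity

/-! ## Frame bookkeeping (general `n`; cf. the landed `n = 2` file
`Theorems/FidelityWitnessesSevenEighthsLawStubSliceElimination.lean`; the output-slice identity is the tree's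
`Theorems.sepMajorant_slice_sum_matMulTensor`) -/

/-- Moving a sum over the frame index out of a double slot sum. -/
theorem slot_sum_comm_frame' {n k : ℕ} (Z : (Fin n × Fin n) → (Fin n × Fin n) → Fin k → ℂ) :
    ∑ b, ∑ c, ∑ s, Z b c s = ∑ s, ∑ b, ∑ c, Z b c s := by
  calc ∑ b, ∑ c, ∑ s, Z b c s = ∑ b, ∑ s, ∑ c, Z b c s :=
        Finset.sum_congr rfl fun b _ => Finset.sum_comm
    _ = ∑ s, ∑ b, ∑ c, Z b c s := Finset.sum_comm

/-- Coefficient identification: if `F = Σ_s d_s e_s` for an orthonormal frame `e`, then `⟨e_t, F⟩ = d_t`. -/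
theorem inner_frame_slice' {n k : ℕ} (e : Fin k → (Fin n × Fin n) → (Fin n × Fin n) → ℂ)
    (he : ∀ s t : Fin k, (∑ b, ∑ c, conj (e s b c) * e t b c) = if s = t then 1 else 0)
    (d : Fin k → ℂ) (F : (Fin n × Fin n) → (Fin n × Fin n) → ℂ)
    (hF : ∀ b c, F b c = ∑ s, d s * e s b c) (t : Fin k) :
    ∑ b, ∑ c, conj (e t b c) * F b c = d t := by
  calc ∑ b, ∑ c, conj (e t b c) * F b c
      = ∑ b, ∑ c, ∑ s, d s * (conj (e t b c) * e s b c) := by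
        refine Finset.sum_congr rfl fun b _ => Finset.sum_congr rfl fun c _ => ?_
        rw [hF b c, Finset.mul_sum]
        exact Finset.sum_congr rfl fun s _ => by ring
    _ = ∑ s, d s * ∑ b, ∑ c, conj (e t b c) * e s b c := by
        rw [slot_sum_comm_frame']
        refine Finset.sum_congr rfl fun s _ => ?_
        rw [Finset.mul_sum]
        exact Finset.sum_congr rfl fun b _ => by rw [Finset.mul_sum]
    _ = ∑ s, d s * (if t = s then 1 else 0) := by
        refine Finset.sum_congr rfl fun s _ => ?_
        rw [he t s]
    _ = d t := by simp

/-- Parseval inside the span of an orthonormal frame: if `F = Σ_s d_s e_s` then `Σ_{b,c} |F b c|² = Σ_s |d_s|²`. -/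
theorem parseval_slice' {n k : ℕ} (e : Fin k → (Fin n × Fin n) → (Fin n × Fin n) → ℂ)
    (he : ∀ s t : Fin k, (∑ b, ∑ c, conj (e s b c) * e t b c) = if s = t then 1 else 0)
    (d : Fin k → ℂ) (F : (Fin n × Fin n) → (Fin n × Fin n) → ℂ)
    (hF : ∀ b c, F b c = ∑ s, d s * e s b c) :
    ∑ b, ∑ c, ‖F b c‖ ^ 2 = ∑ s, ‖d s‖ ^ 2 := by
  have hFc : ∀ b c, conj (F b c) = ∑ s, conj (d s) * conj (e s b c) := by
    intro b c
    rw [hF b c, map_sum]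
    exact Finset.sum_congr rfl fun s _ => by rw [map_mul]
  have hC : (∑ b, ∑ c, conj (F b c) * F b c) = ∑ s, conj (d s) * d s := by
    calc ∑ b, ∑ c, conj (F b c) * F b c
        = ∑ b, ∑ c, ∑ s, conj (d s) * (conj (e s b c) * F b c) := by
          refine Finset.sum_congr rfl fun b _ => Finset.sum_congr rfl fun c _ => ?_
          rw [hFc b c, Finset.sum_mul]
          exact Finset.sum_congr rfl fun s _ => by ring
      _ = ∑ s, conj (d s) * ∑ b, ∑ c, conj (e s b c) * F b c := by
          rw [slot_sum_comm_frame']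
          refine Finset.sum_congr rfl fun s _ => ?_
          rw [Finset.mul_sum]
          exact Finset.sum_congr rfl fun b _ => by rw [Finset.mul_sum]
      _ = ∑ s, conj (d s) * d s :=
          Finset.sum_congr rfl fun s _ => by rw [inner_frame_slice' e he d F hF s]
  simp_rw [Complex.conj_mul'] at hC
  exact_mod_cast hC

/-! ## Twisted captures -/

/-- The coefficient `c_{s,a} = Σ_{m,m'} e_s (a.1,m) (m',a.2) · A m m'` of the `A`-twisted capture. -/
def twCoeff {n d : ℕ} (e : Fin d → (Fin n × Fin n) → (Fin n × Fin n) → ℂ) (A : Matrix (Fin n) (Fin n) ℂ)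
    (s : Fin d) (a : Fin n × Fin n) : ℂ :=
  ∑ m : Fin n, ∑ m' : Fin n, e s (a.1, m) (m', a.2) * A m m'

/-- The `A`-TWISTED CAPTURE `cap_A(e) = Σ_s Σ_a |c_{s,a}|²` (for `A = 1`: the line's capture `cap e`; in general
`⟨conj A| Tr_{κν} P_E |conj A⟩` for an orthonormal frame `e` spanning `E`). -/
def capTwist {n d : ℕ} (e : Fin d → (Fin n × Fin n) → (Fin n × Fin n) → ℂ) (A : Matrix (Fin n) (Fin n) ℂ) : ℝ :=
  ∑ s, ∑ a : Fin n × Fin n, ‖twCoeff e A s a‖ ^ 2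

/-- The extremal tensor of the twisted capture: output slices `S(a,·,·) = Σ_s conj(c_{s,a}) e_s`. -/
def twTensor {n d : ℕ} (e : Fin d → (Fin n × Fin n) → (Fin n × Fin n) → ℂ) (A : Matrix (Fin n) (Fin n) ℂ) :
    (Fin n × Fin n) → (Fin n × Fin n) → (Fin n × Fin n) → ℂ :=
  fun a b c => ∑ s, conj (twCoeff e A s a) * e s b c

/-- Pushing the twist onto the third slot: `(twist A S)(a,b,(m,ν)) = Σ_{m'} A m m' · S(a,b,(m',ν))`. -/
def twist {n : ℕ} (A : Matrix (Fin n) (Fin n) ℂ)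
    (S : (Fin n × Fin n) → (Fin n × Fin n) → (Fin n × Fin n) → ℂ) :
    (Fin n × Fin n) → (Fin n × Fin n) → (Fin n × Fin n) → ℂ :=
  fun a b c => ∑ m' : Fin n, A c.1 m' * S a b (m', c.2)

/-- The twisted extremal tensor pairs with `⟨n,n,n⟩` to exactly the twisted capture:
`Σ (twist A S)·T = cap_A(e)` for `S = twTensor e A`. -/
theorem sum_twist_twTensor_mul_matMulTensor {n d : ℕ} (e : Fin d → (Fin n × Fin n) → (Fin n × Fin n) → ℂ)
    (A : Matrix (Fin n) (Fin n) ℂ) :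
    (∑ a, ∑ b, ∑ c, twist A (twTensor e A) a b c * matMulTensor ℂ n n n a b c) = ((capTwist e A : ℝ) : ℂ) := by
  have hsq : ∀ z : ℂ, ((‖z‖ : ℝ) : ℂ) ^ 2 = conj z * z := fun z => by
    rw [mul_comm, Complex.mul_conj, Complex.normSq_eq_norm_sq]; norm_cast
  calc (∑ a, ∑ b, ∑ c, twist A (twTensor e A) a b c * matMulTensor ℂ n n n a b c)
      = ∑ a : Fin n × Fin n, ∑ m : Fin n, twist A (twTensor e A) a (a.1, m) (m, a.2) :=
        Finset.sum_congr rfl fun a _ => sepMajorant_slice_sum_matMulTensor _ a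
    _ = ∑ a : Fin n × Fin n, ∑ s, conj (twCoeff e A s a) * twCoeff e A s a := by
        refine Finset.sum_congr rfl fun a _ => ?_
        -- unfold the twist and the extremal tensor, then regroup the finite sums
        calc ∑ m : Fin n, twist A (twTensor e A) a (a.1, m) (m, a.2)
            = ∑ m : Fin n, ∑ m' : Fin n, ∑ s, A m m' * (conj (twCoeff e A s a) * e s (a.1, m) (m', a.2)) := by
              refine Finset.sum_congr rfl fun m _ => ?_
              simp only [twist, twTensor]
              refine Finset.sum_congr rfl fun m' _ => ?_
              rw [Finset.mul_sum]
          _ = ∑ m : Fin n, ∑ s, ∑ m' : Fin n, A m m' * (conj (twCoeff e A s a) * e s (a.1, m) (m', a.2)) :=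
              Finset.sum_congr rfl fun m _ => Finset.sum_comm
          _ = ∑ s, ∑ m : Fin n, ∑ m' : Fin n, A m m' * (conj (twCoeff e A s a) * e s (a.1, m) (m', a.2)) :=
              Finset.sum_comm
          _ = ∑ s, conj (twCoeff e A s a) * twCoeff e A s a := by
              refine Finset.sum_congr rfl fun s _ => ?_
              rw [twCoeff, Finset.mul_sum]
              refine Finset.sum_congr rfl fun m _ => ?_
              rw [Finset.mul_sum]
              exact Finset.sum_congr rfl fun m' _ => by ring
    _ = ((capTwist e A : ℝ) : ℂ) := by
        simp only [capTwist, Complex.ofReal_sum, Complex.ofReal_pow, hsq]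
        rw [Finset.sum_comm]

/-- Parseval: the extremal tensor has squared norm exactly the twisted capture (orthonormal `e`). -/
theorem normSq_twTensor {n d : ℕ} (e : Fin d → (Fin n × Fin n) → (Fin n × Fin n) → ℂ)
    (he : ∀ s t : Fin d, (∑ b, ∑ c, conj (e s b c) * e t b c) = if s = t then 1 else 0)
    (A : Matrix (Fin n) (Fin n) ℂ) :
    (∑ a, ∑ b, ∑ c, ‖twTensor e A a b c‖ ^ 2) = capTwist e A := by
  calc (∑ a, ∑ b, ∑ c, ‖twTensor e A a b c‖ ^ 2) = ∑ a : Fin n × Fin n, ∑ s, ‖twCoeff e A s a‖ ^ 2 := by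
        refine Finset.sum_congr rfl fun a _ => ?_
        rw [parseval_slice' e he (fun s => conj (twCoeff e A s a)) (twTensor e A a) (fun b c => rfl)]
        exact Finset.sum_congr rfl fun s _ => by rw [Complex.norm_conj]
    _ = capTwist e A := by unfold capTwist; exact Finset.sum_comm

/-- A contraction on the third slot does not increase the norm: `‖twist A S‖² ≤ ‖S‖²` when `‖A x‖ ≤ ‖x‖`. -/
theorem normSq_twist_le {n : ℕ} (A : Matrix (Fin n) (Fin n) ℂ)
    (hA : ∀ x : Fin n → ℂ, ∑ i, ‖(A.mulVec x) i‖ ^ 2 ≤ ∑ i, ‖x i‖ ^ 2)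
    (S : (Fin n × Fin n) → (Fin n × Fin n) → (Fin n × Fin n) → ℂ) :
    (∑ a, ∑ b, ∑ c, ‖twist A S a b c‖ ^ 2) ≤ ∑ a, ∑ b, ∑ c, ‖S a b c‖ ^ 2 := by
  refine Finset.sum_le_sum fun a _ => Finset.sum_le_sum fun b _ => ?_
  -- split the third slot `c = (m, ν)` as `Σ_ν Σ_m`
  calc (∑ c, ‖twist A S a b c‖ ^ 2) = ∑ ν : Fin n, ∑ m : Fin n, ‖twist A S a b (m, ν)‖ ^ 2 :=
        Fintype.sum_prod_type_right (f := fun c : Fin n × Fin n => ‖twist A S a b c‖ ^ 2)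
    _ ≤ ∑ ν : Fin n, ∑ m' : Fin n, ‖S a b (m', ν)‖ ^ 2 := by
        refine Finset.sum_le_sum fun ν _ => ?_
        have h := hA (fun m' => S a b (m', ν))
        simpa only [twist, Matrix.mulVec, dotProduct] using h
    _ = ∑ c, ‖S a b c‖ ^ 2 :=
        (Fintype.sum_prod_type_right (f := fun c : Fin n × Fin n => ‖S a b c‖ ^ 2)).symm

/-- The twisted extremal tensor is a sum of `r` triads whenever the frame lies in the span of `r` products
`u_l ⊗ v_l`: slice by slice `S(a,·,·) ∈ span{u_l ⊗ v_l}`, and the twist acts on the `v`-factor only. -/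
theorem exists_twist_twTensor_eq_sum_triad {n d r : ℕ} (e : Fin d → (Fin n × Fin n) → (Fin n × Fin n) → ℂ)
    (u v : Fin r → (Fin n × Fin n) → ℂ)
    (hps : ∀ s, e s ∈ Submodule.span ℂ (Set.range fun l : Fin r => fun b c => u l b * v l c))
    (A : Matrix (Fin n) (Fin n) ℂ) :
    ∃ (w : Fin r → (Fin n × Fin n) → ℂ) (v' : Fin r → (Fin n × Fin n) → ℂ),
      twist A (twTensor e A) = ∑ l, triad (w l) (u l) (v' l) := by
  classical
  -- coefficients of the frame vectors in the products
  have hβ : ∀ s, ∃ β : Fin r → ℂ, ∑ l, β l • (fun b c => u l b * v l c) = e s := fun s =>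
    (Submodule.mem_span_range_iff_exists_fun ℂ).mp (hps s)
  choose β hβ using hβ
  have hexp : ∀ s b c, e s b c = ∑ l, β s l * (u l b * v l c) := by
    intro s b c
    have h := congrFun (congrFun (hβ s) b) c
    simpa [Finset.sum_apply, Pi.smul_apply, smul_eq_mul] using h.symm
  refine ⟨fun l a => ∑ s, conj (twCoeff e A s a) * β s l,
    fun l c => ∑ m' : Fin n, A c.1 m' * v l (m', c.2), ?_⟩
  funext a b c
  simp only [Finset.sum_apply, triad_apply, twist, twTensor]
  calc ∑ m' : Fin n, A c.1 m' * ∑ s, conj (twCoeff e A s a) * e s b (m', c.2)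
      = ∑ m' : Fin n, ∑ s, ∑ l, A c.1 m' * (conj (twCoeff e A s a) * (β s l * (u l b * v l (m', c.2)))) := by
        refine Finset.sum_congr rfl fun m' _ => ?_
        rw [Finset.mul_sum]
        refine Finset.sum_congr rfl fun s _ => ?_
        rw [hexp s b (m', c.2), Finset.mul_sum, Finset.mul_sum]
    _ = ∑ l, ∑ s, ∑ m' : Fin n, A c.1 m' * (conj (twCoeff e A s a) * (β s l * (u l b * v l (m', c.2)))) := by
        rw [Finset.sum_comm]
        refine (Finset.sum_congr rfl fun s _ => Finset.sum_comm).trans ?_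
        exact Finset.sum_comm
    _ = ∑ l, (∑ s, conj (twCoeff e A s a) * β s l) * u l b * ∑ m' : Fin n, A c.1 m' * v l (m', c.2) := by
        refine Finset.sum_congr rfl fun l _ => ?_
        rw [Finset.sum_mul, Finset.sum_mul]
        refine Finset.sum_congr rfl fun s _ => ?_
        rw [Finset.mul_sum]
        exact Finset.sum_congr rfl fun m' _ => by ring

/-- Hence its rank is at most `r`. -/
theorem tensorRank_twist_twTensor_le {n d r : ℕ} (e : Fin d → (Fin n × Fin n) → (Fin n × Fin n) → ℂ)
    (u v : Fin r → (Fin n × Fin n) → ℂ)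
    (hps : ∀ s, e s ∈ Submodule.span ℂ (Set.range fun l : Fin r => fun b c => u l b * v l c))
    (A : Matrix (Fin n) (Fin n) ℂ) :
    tensorRank (twist A (twTensor e A)) ≤ r := by
  obtain ⟨w, v', h⟩ := exists_twist_twTensor_eq_sum_triad e u v hps A
  exact tensorRank_le_of_eq_sum w u v' h

/-- **Twisted captures are bounded by the crux body.** If `|⟨S,⟨n,n,n⟩⟩|² ≤ C n^{3−2δ} ‖S‖²` for all `S` of rank
`≤ n²` (the body of `DiagonalPowerDecay` at `(C, δ)`, `0 ≤ C`), then for every orthonormal frame `e` inside the span of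
`r ≤ n²` products and every contraction `A`: `cap_A(e) ≤ C n^{3−2δ}`. -/
theorem capTwist_le_of_body {C δ : ℝ} (hC : 0 ≤ C)
    (hB : ∀ n : ℕ, ∀ S : (Fin n × Fin n) → (Fin n × Fin n) → (Fin n × Fin n) → ℂ, tensorRank S ≤ n ^ 2 →
      ‖∑ a, ∑ b, ∑ c, S a b c * matMulTensor ℂ n n n a b c‖ ^ 2 ≤
        C * (n : ℝ) ^ (3 - 2 * δ) * ∑ a, ∑ b, ∑ c, ‖S a b c‖ ^ 2)
    {n d r : ℕ} (hr : r ≤ n ^ 2) (u v : Fin r → (Fin n × Fin n) → ℂ)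
    (e : Fin d → (Fin n × Fin n) → (Fin n × Fin n) → ℂ)
    (he : ∀ s t : Fin d, (∑ b, ∑ c, conj (e s b c) * e t b c) = if s = t then 1 else 0)
    (hps : ∀ s, e s ∈ Submodule.span ℂ (Set.range fun l : Fin r => fun b c => u l b * v l c))
    (A : Matrix (Fin n) (Fin n) ℂ) (hA : ∀ x : Fin n → ℂ, ∑ i, ‖(A.mulVec x) i‖ ^ 2 ≤ ∑ i, ‖x i‖ ^ 2) :
    capTwist e A ≤ C * (n : ℝ) ^ (3 - 2 * δ) := by
  set S := twist A (twTensor e A) with hSdef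
  have hrank : tensorRank S ≤ n ^ 2 := (tensorRank_twist_twTensor_le e u v hps A).trans hr
  have hbody := hB n S hrank
  have hov : ‖∑ a, ∑ b, ∑ c, S a b c * matMulTensor ℂ n n n a b c‖ ^ 2 = capTwist e A ^ 2 := by
    rw [hSdef, sum_twist_twTensor_mul_matMulTensor, Complex.norm_real, Real.norm_eq_abs, sq_abs]
  have hnorm : (∑ a, ∑ b, ∑ c, ‖S a b c‖ ^ 2) ≤ capTwist e A := by
    rw [← normSq_twTensor e he A]
    exact normSq_twist_le A hA _
  have hK : 0 ≤ C * (n : ℝ) ^ (3 - 2 * δ) := mul_nonneg hC (Real.rpow_nonneg (Nat.cast_nonneg n) _)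
  have hcap : 0 ≤ capTwist e A := by unfold capTwist; positivity
  have key : capTwist e A ^ 2 ≤ C * (n : ℝ) ^ (3 - 2 * δ) * capTwist e A := by
    rw [← hov]
    exact hbody.trans (mul_le_mul_of_nonneg_left hnorm hK)
  rcases hcap.lt_or_eq with hpos | hzero
  · have : capTwist e A * capTwist e A ≤ C * (n : ℝ) ^ (3 - 2 * δ) * capTwist e A := by rw [← sq]; exact key
    exact le_of_mul_le_mul_right this hpos
  · rw [← hzero]; exact hK

/-- **Twisted captures under the body, unfolded statement (registered sub-goal `twistedCapture_le_of_body`).** -/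
theorem twistedCapture_le_of_body {C δ : ℝ} (hC : 0 ≤ C)
    (hB : ∀ n : ℕ, ∀ S : (Fin n × Fin n) → (Fin n × Fin n) → (Fin n × Fin n) → ℂ, tensorRank S ≤ n ^ 2 →
      ‖∑ a, ∑ b, ∑ c, S a b c * matMulTensor ℂ n n n a b c‖ ^ 2 ≤
        C * (n : ℝ) ^ (3 - 2 * δ) * ∑ a, ∑ b, ∑ c, ‖S a b c‖ ^ 2)
    {n d r : ℕ} (hr : r ≤ n ^ 2) (u v : Fin r → (Fin n × Fin n) → ℂ)
    (e : Fin d → (Fin n × Fin n) → (Fin n × Fin n) → ℂ)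
    (he : ∀ s t : Fin d, (∑ b, ∑ c, conj (e s b c) * e t b c) = if s = t then 1 else 0)
    (hps : ∀ s, e s ∈ Submodule.span ℂ (Set.range fun l : Fin r => fun b c => u l b * v l c))
    (A : Matrix (Fin n) (Fin n) ℂ) (hA : ∀ x : Fin n → ℂ, ∑ i, ‖(A.mulVec x) i‖ ^ 2 ≤ ∑ i, ‖x i‖ ^ 2) :
    (∑ s, ∑ a : Fin n × Fin n, ‖∑ m : Fin n, ∑ m' : Fin n, e s (a.1, m) (m', a.2) * A m m'‖ ^ 2) ≤
      C * (n : ℝ) ^ (3 - 2 * δ) :=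
  capTwist_le_of_body hC hB hr u v e he hps A hA

end Summit.MatrixMultiplication.MatrixMultiplication.Theorems.DiagonalPowerDecay

end
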